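import Summits.AtomisticToContinuum.HydrodynamicLimit.Theorems.TwoClocksClampedEntropyClockDiscreteEntropyGronwall
import HarnessLib

/-!
# Discrete entropy Gronwall over windows, variable-rate form (stub G1′)

Helper file (`--supports stmt-AtomisticToContinuum-9133`) proving the registered stub
`discreteEntropyGronwallVar` of the lead's skeleton for the crux
`Summit.AtomisticToContinuum.HydrodynamicLimit.Theses.ImplosionDichotomy.HydroLimitInBand`
(line `IdeatorOneSketch`). This is the purely real-analytic last step of Yau's relative-entropy
clock (Yau 1991, §2): `H N s` is the relative entropy of the true law at time `s` with respect to an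
explicit local-Gibbs reference, the one-window estimates (full windows of length `w N` inside
`[0, t]`, plus one last partial window) are telescoped by a discrete Gronwall argument into
`H N t / (N+1) → 0`.

Difference from the landed fixed-rate lemma
`QuenchedCellClock.stub_discreteEntropyGronwall`: here the Gronwall rate `A` and the per-window
error `ε` are chosen *per target accuracy* `δ`, subject to the explicit slack
`exp (A t) · (t ε) + ε < δ` (a velocity cut-off forces the rate to grow as the error shrinks).

Proof summary. Fix `δ > 0` and take `A, ε, w, N₀` from the hypothesis. For `N ≥ N₀` the one-`N`
bound `QuenchedCellClock.window_gronwall_bound` gives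
`H N t ≤ exp (A t) (H N 0 + t (N+1) ε) + (N+1) ε`, i.e.
`H N t / (N+1) ≤ exp (A t) · (H N 0 / (N+1)) + (exp (A t) · t ε + ε)`. Since `H N 0 / (N+1) → 0`,
eventually `exp (A t) · (H N 0 / (N+1)) < δ - (exp (A t) · t ε + ε)` (positive slack), whence
`0 ≤ H N t / (N+1) < δ` eventually.
-/

noncomputable section

open Filter Topology

namespace Summit.AtomisticToContinuum.HydrodynamicLimit.Theorems.HydroLimitInBandClock

/-- **Stub G1′ — discrete entropy Gronwall over windows, variable rate.** Nonnegative quantities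
`H N s` with `H N 0 / (N+1) → 0`; for every target accuracy `δ > 0` there are a rate `A ≥ 0`, an
error `ε > 0` with slack `exp (A t) · (t ε) + ε < δ`, window lengths `w N > 0` and `N₀` such that for
`N ≥ N₀` one full window costs `H N (s + w N) ≤ (1 + A·w N) H N s + w N (N+1) ε` (windows inside
`[0, t]`) and the last partial window costs `H N t ≤ H N s + (N+1) ε` (`t - w N ≤ s ≤ t`).
Then `H N t / (N+1) → 0`. [cite: Yau1991, §2] -/
theorem discreteEntropyGronwallVar :
    ∀ (H : ℕ → ℝ → ℝ) (t : ℝ), 0 < t → (∀ N s, 0 ≤ H N s) →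
    Tendsto (fun N : ℕ => H N 0 / ((N : ℝ) + 1)) atTop (𝓝 0) →
    (∀ δ : ℝ, 0 < δ → ∃ A : ℝ, 0 ≤ A ∧ ∃ ε : ℝ, 0 < ε ∧ Real.exp (A * t) * (t * ε) + ε < δ ∧
      ∃ w : ℕ → ℝ, (∀ N, 0 < w N) ∧ ∃ N₀ : ℕ, ∀ N : ℕ, N₀ ≤ N →
        (∀ s : ℝ, 0 ≤ s → s + w N ≤ t →
          H N (s + w N) ≤ (1 + A * w N) * H N s + w N * ((N : ℝ) + 1) * ε) ∧
        (∀ s : ℝ, 0 ≤ s → s ≤ t → t ≤ s + w N → H N t ≤ H N s + ((N : ℝ) + 1) * ε)) →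
    Tendsto (fun N : ℕ => H N t / ((N : ℝ) + 1)) atTop (𝓝 0) := by
  intro H t ht hH0 hzero hstep
  rw [Metric.tendsto_atTop]
  intro δ hδ
  obtain ⟨A, hA, ε, hε, hslack, w, hw, N₀, hN₀⟩ := hstep δ hδ
  -- the one-`N` bound, for `N ≥ N₀`
  have key : ∀ᶠ N : ℕ in atTop,
      H N t / ((N : ℝ) + 1) ≤ Real.exp (A * t) * (H N 0 / ((N : ℝ) + 1)) +
        (Real.exp (A * t) * (t * ε) + ε) := by
    refine Filter.eventually_atTop.2 ⟨N₀, fun N hN => ?_⟩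
    obtain ⟨hfull, hpart⟩ := hN₀ N hN
    have hM : (0 : ℝ) < (N : ℝ) + 1 := by positivity
    have hb := QuenchedCellClock.window_gronwall_bound (H N) ht hA (hw N) hM hε.le (hH0 N)
      hfull hpart
    rw [div_le_iff₀ hM]
    have hx : Real.exp (A * t) * (H N 0 / ((N : ℝ) + 1) * ((N : ℝ) + 1)) =
        Real.exp (A * t) * H N 0 := by
      rw [div_mul_cancel₀ _ hM.ne']
    linarith [hb, hx]
  -- the slack is positive, and `exp (A t) · (H N 0 / (N+1))` is eventually below it
  have hgap : 0 < δ - (Real.exp (A * t) * (t * ε) + ε) := by linarith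
  have hlim : Tendsto (fun N : ℕ => Real.exp (A * t) * (H N 0 / ((N : ℝ) + 1))) atTop (𝓝 0) := by
    have h := hzero.const_mul (Real.exp (A * t))
    rwa [mul_zero] at h
  have h2 : ∀ᶠ N : ℕ in atTop,
      Real.exp (A * t) * (H N 0 / ((N : ℝ) + 1)) < δ - (Real.exp (A * t) * (t * ε) + ε) :=
    hlim.eventually (gt_mem_nhds hgap)
  obtain ⟨N₁, hN₁⟩ := Filter.eventually_atTop.1 (key.and h2)
  refine ⟨N₁, fun N hN => ?_⟩
  obtain ⟨ha, hb⟩ := hN₁ N hN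
  rw [Real.dist_eq, sub_zero, abs_of_nonneg (div_nonneg (hH0 N t) (by positivity))]
  linarith

end Summit.AtomisticToContinuum.HydrodynamicLimit.Theorems.HydroLimitInBandClock

end
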